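import Summits.QuantumFields.GaugeBoot.PeriodicBoxTiltedFrames
import HarnessLib

/-!
# The doubly tilted periodic box: tilted diagonal frames in two disjoint coordinate planes at once
# (gauge-boot, L3 structural supplement)

HONEST FRAMING (cell `pub-gaugeboot`, page 1 of every file): the venture produces certified bounds
on lattice expectations at stated coupling, gauge group, dimension and torus size; NOT a mass gap,
NOT a continuum limit, NOT a string tension; NOT Yang–Mills-summit-bearing (barriers
`FixedCouplingUltralocality`, `PerturbativeInvisibility`). This module is a small STRUCTURAL result
about the lane's reflection mechanisms; it bounds no expectation and discharges nothing else.

Sharpness of the compatibility rules of `TiltedFrameNoGo.lean` / `TiltedFrameRigidity.lean` (on one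
periodic volume the planes carrying tilted diagonal frames are pairwise disjoint and avoid the axes
carrying site frames). For two DISJOINT coordinate planes `{i, j}`, `{i', j'}` (four distinct axes,
so `d ≥ 4`) the **doubly tilted box** `ℤ^d / Γ₂`,
`Γ₂ = {x : 2M ∣ x_i + x_j, 2P ∣ x_i - x_j, 2M' ∣ x_{i'} + x_{j'}, 2P' ∣ x_{i'} - x_{j'}, L ∣ x_k else}`
(`doublyTiltedLattice`, `mem_doublyTiltedLattice_iff`; Fröhlich–Israel–Lieb–Simon's 45° box taken in
both planes; finitely many sites, `finite_doublyTiltedSite`), carries — by the classification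
`PeriodicBox.exists_isTiltedFrame_iff` / `PeriodicBox.isTiltedFrame` — a tilted diagonal frame in
the plane `(i, j)` with half period `P` AND one in the plane `(i', j')` with half period `P'`
(`isTiltedFrame_doublyTilted_left/right/both`, `P, P' ≥ 2`), hence (the lane's positivity theorem
`IsTiltedFrame.integral_conj_mul_nonneg`, not re-derived here) diagonal reflection positivity of the
Wilson theory in BOTH hyperplanes `x_i = x_j` and `x_{i'} = x_{j'}` on one finite volume; along every
further axis `k ∉ {i, j, i', j'}` of even period `L = 2Q ≥ 4` it carries a site frame as well
(`isSiteFrame_doublyTilted_other`, `d ≥ 5`), and along the four in-plane axes it carries none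
(`not_isSiteFrame_doublyTilted_inPlane`, the no-go). In `d = 4` with the planes `(0, 1)`, `(2, 3)`:
both diagonal families of Kazakov–Zheng's bootstrap are finite-volume theorems on `ℤ^4 / Γ₂`, and
neither the site nor the link family along any axis is available there by the frame mechanism.

References: J. Fröhlich, R. Israel, E. H. Lieb, B. Simon, J. Stat. Phys. 22 (1980) 297, §3 (Model
3.1); K. Osterwalder, E. Seiler, Ann. Phys. 110 (1978) 440, §2; V. Kazakov, Z. Zheng,
arXiv:2203.11360 §3.1.
-/

open QuotientAddGroup

namespace Summit.QuantumFields.GaugeBoot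

namespace TiltedRP

/-! ## The doubly tilted lattice `Γ₂` -/

section TwoPlanes

variable (d : ℕ) (i j i' j' : Fin d) (M P M' P' L : ℕ)

/-- `x ↦ (x_k mod L)_{k ∉ {i, j, i', j'}}` (the four in-plane components are sent to `0`). -/
def restHom₄ : (Fin d → ℤ) →+ (Fin d → ZMod L) :=
  AddMonoidHom.pi fun k => if k = i ∨ k = j ∨ k = i' ∨ k = j' then 0 else
    (Int.castAddHom (ZMod L)).comp (Pi.evalAddMonoidHom (fun _ : Fin d => ℤ) k)

/-- The homomorphism `ℤ^d → (ℤ/2M × ℤ/2P) × (ℤ/2M' × ℤ/2P') × (ℤ/L)^d` whose kernel is `Γ₂`. -/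
def doublyTiltedHom : (Fin d → ℤ) →+
    (ZMod (2 * M) × ZMod (2 * P)) × (ZMod (2 * M') × ZMod (2 * P')) × (Fin d → ZMod L) :=
  ((sumHom d i j M).prod (diffHom d i j P)).prod
    (((sumHom d i' j' M').prod (diffHom d i' j' P')).prod (restHom₄ d i j i' j' L))

/-- **The doubly tilted lattice** `Γ₂ = {x : 2M ∣ x_i + x_j, 2P ∣ x_i - x_j, 2M' ∣ x_{i'} + x_{j'},
2P' ∣ x_{i'} - x_{j'}, L ∣ x_k (k ∉ {i, j, i', j'})}`: sides at 45° in both planes. -/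
def doublyTiltedLattice : AddSubgroup (Fin d → ℤ) :=
  (doublyTiltedHom d i j i' j' M P M' P' L).ker

/-- **Membership in `Γ₂`, as divisibilities.** -/
theorem mem_doublyTiltedLattice_iff (x : Fin d → ℤ) :
    x ∈ doublyTiltedLattice d i j i' j' M P M' P' L ↔
      (((2 * M : ℕ) : ℤ) ∣ x i + x j ∧ ((2 * P : ℕ) : ℤ) ∣ x i - x j) ∧
      (((2 * M' : ℕ) : ℤ) ∣ x i' + x j' ∧ ((2 * P' : ℕ) : ℤ) ∣ x i' - x j') ∧
        ∀ k, k ≠ i → k ≠ j → k ≠ i' → k ≠ j' → (L : ℤ) ∣ x k := by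
  rw [doublyTiltedLattice, AddMonoidHom.mem_ker]
  simp only [doublyTiltedHom, sumHom, diffHom, restHom₄, AddMonoidHom.prod_apply, Prod.mk_eq_zero,
    AddMonoidHom.coe_comp, Function.comp_apply, AddMonoidHom.add_apply, AddMonoidHom.sub_apply,
    Pi.evalAddMonoidHom_apply, Int.coe_castAddHom, ZMod.intCast_zmod_eq_zero_iff_dvd]
  constructor
  · rintro ⟨h12, h34, h5⟩
    refine ⟨h12, h34, fun k hki hkj hki' hkj' => ?_⟩
    have h := congrFun h5 k
    simp only [AddMonoidHom.pi_apply, hki, hkj, hki', hkj', or_self, ↓reduceIte,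
      AddMonoidHom.coe_comp, Function.comp_apply, Pi.evalAddMonoidHom_apply, Int.coe_castAddHom,
      Pi.zero_apply] at h
    exact (ZMod.intCast_zmod_eq_zero_iff_dvd _ _).1 h
  · rintro ⟨h12, h34, h5⟩
    refine ⟨h12, h34, ?_⟩
    funext k
    simp only [AddMonoidHom.pi_apply, Pi.zero_apply]
    split_ifs with hk
    · rfl
    · simp only [not_or] at hk
      simpa [ZMod.intCast_zmod_eq_zero_iff_dvd] using h5 k hk.1 hk.2.1 hk.2.2.1 hk.2.2.2

/-- The doubly tilted box `ℤ^d / Γ₂` is finite (it maps injectively into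
`(ℤ/2M × ℤ/2P) × (ℤ/2M' × ℤ/2P') × (ℤ/L)^d`). -/
theorem finite_doublyTiltedSite [NeZero M] [NeZero P] [NeZero M'] [NeZero P'] [NeZero L] :
    Finite ((Fin d → ℤ) ⧸ doublyTiltedLattice d i j i' j' M P M' P' L) := by
  haveI : NeZero (2 * M) := ⟨by have := NeZero.ne M; omega⟩
  haveI : NeZero (2 * P) := ⟨by have := NeZero.ne P; omega⟩
  haveI : NeZero (2 * M') := ⟨by have := NeZero.ne M'; omega⟩
  haveI : NeZero (2 * P') := ⟨by have := NeZero.ne P'; omega⟩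
  exact Finite.of_equiv _
    (QuotientAddGroup.quotientKerEquivRange (doublyTiltedHom d i j i' j' M P M' P' L)).symm.toEquiv

/-! ## The two tilted diagonal frames -/

variable {d i j i' j'}

/-- Every period has `2P ∣ x_i - x_j`. -/
theorem dvd_diff_of_mem_doublyTilted_left {x : Fin d → ℤ}
    (hx : x ∈ doublyTiltedLattice d i j i' j' M P M' P' L) : ((2 * P : ℕ) : ℤ) ∣ x i - x j :=
  ((mem_doublyTiltedLattice_iff d i j i' j' M P M' P' L x).1 hx).1.2

/-- Every period has `2P' ∣ x_{i'} - x_{j'}`. -/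
theorem dvd_diff_of_mem_doublyTilted_right {x : Fin d → ℤ}
    (hx : x ∈ doublyTiltedLattice d i j i' j' M P M' P' L) : ((2 * P' : ℕ) : ℤ) ∣ x i' - x j' :=
  ((mem_doublyTiltedLattice_iff d i j i' j' M P M' P' L x).1 hx).2.1.2

/-- `P (e_i - e_j)` is a period (the planes are disjoint). -/
theorem nsmul_diff_mem_doublyTilted_left (hij : i ≠ j) (hi'i : i' ≠ i) (hi'j : i' ≠ j)
    (hj'i : j' ≠ i) (hj'j : j' ≠ j) :
    P • (Pi.single i (1 : ℤ) - Pi.single j (1 : ℤ) : Fin d → ℤ) ∈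
      doublyTiltedLattice d i j i' j' M P M' P' L := by
  rw [mem_doublyTiltedLattice_iff]
  simp only [Pi.smul_apply, Pi.sub_apply, Pi.single_eq_same, Pi.single_eq_of_ne hij,
    Pi.single_eq_of_ne hij.symm, Pi.single_eq_of_ne hi'i, Pi.single_eq_of_ne hi'j,
    Pi.single_eq_of_ne hj'i, Pi.single_eq_of_ne hj'j, nsmul_eq_mul]
  refine ⟨⟨⟨0, by ring⟩, ⟨1, by push_cast; ring⟩⟩, ⟨⟨0, by ring⟩, ⟨0, by ring⟩⟩,
    fun k hki hkj _ _ => ?_⟩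
  rw [Pi.single_eq_of_ne hki, Pi.single_eq_of_ne hkj, sub_zero, mul_zero]
  exact dvd_zero _

/-- `P' (e_{i'} - e_{j'})` is a period. -/
theorem nsmul_diff_mem_doublyTilted_right (hi'j' : i' ≠ j') (hi'i : i' ≠ i) (hi'j : i' ≠ j)
    (hj'i : j' ≠ i) (hj'j : j' ≠ j) :
    P' • (Pi.single i' (1 : ℤ) - Pi.single j' (1 : ℤ) : Fin d → ℤ) ∈
      doublyTiltedLattice d i j i' j' M P M' P' L := by
  rw [mem_doublyTiltedLattice_iff]
  simp only [Pi.smul_apply, Pi.sub_apply, Pi.single_eq_same, Pi.single_eq_of_ne hi'j',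
    Pi.single_eq_of_ne hi'j'.symm, Pi.single_eq_of_ne hi'i.symm, Pi.single_eq_of_ne hi'j.symm,
    Pi.single_eq_of_ne hj'i.symm, Pi.single_eq_of_ne hj'j.symm, nsmul_eq_mul]
  refine ⟨⟨⟨0, by ring⟩, ⟨0, by ring⟩⟩, ⟨⟨0, by ring⟩, ⟨1, by push_cast; ring⟩⟩,
    fun k _ _ hki' hkj' => ?_⟩
  rw [Pi.single_eq_of_ne hki', Pi.single_eq_of_ne hkj', sub_zero, mul_zero]
  exact dvd_zero _

/-- **The doubly tilted box carries the tilted diagonal frame of the plane `(i, j)`** (the swap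
`[x] ↦ [x ∘ (i j)]`, the height `x_i - x_j mod 2P`; `P ≥ 2`, planes disjoint). -/
theorem isTiltedFrame_doublyTilted_left (hij : i ≠ j) (hi'i : i' ≠ i) (hi'j : i' ≠ j)
    (hj'i : j' ≠ i) (hj'j : j' ≠ j) (hP : 2 ≤ P) :
    IsTiltedFrame (PeriodicBox.unit (doublyTiltedLattice d i j i' j' M P M' P' L)) i j
      (PeriodicBox.mirror (PeriodicBox.le_comap_swapHom hij
        (nsmul_diff_mem_doublyTilted_left M P M' P' L hij hi'i hi'j hj'i hj'j)
        (fun _ hx => dvd_diff_of_mem_doublyTilted_left M P M' P' L hx)))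
      P (PeriodicBox.diagHeight P (fun _ hx => dvd_diff_of_mem_doublyTilted_left M P M' P' L hx)) :=
  PeriodicBox.isTiltedFrame hij hP
    (nsmul_diff_mem_doublyTilted_left M P M' P' L hij hi'i hi'j hj'i hj'j)
    (fun _ hx => dvd_diff_of_mem_doublyTilted_left M P M' P' L hx)

/-- **… and the tilted diagonal frame of the plane `(i', j')`** (the swap `[x] ↦ [x ∘ (i' j')]`,
the height `x_{i'} - x_{j'} mod 2P'`; `P' ≥ 2`). -/
theorem isTiltedFrame_doublyTilted_right (hi'j' : i' ≠ j') (hi'i : i' ≠ i) (hi'j : i' ≠ j)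
    (hj'i : j' ≠ i) (hj'j : j' ≠ j) (hP' : 2 ≤ P') :
    IsTiltedFrame (PeriodicBox.unit (doublyTiltedLattice d i j i' j' M P M' P' L)) i' j'
      (PeriodicBox.mirror (PeriodicBox.le_comap_swapHom hi'j'
        (nsmul_diff_mem_doublyTilted_right M P M' P' L hi'j' hi'i hi'j hj'i hj'j)
        (fun _ hx => dvd_diff_of_mem_doublyTilted_right M P M' P' L hx)))
      P' (PeriodicBox.diagHeight P'
        (fun _ hx => dvd_diff_of_mem_doublyTilted_right M P M' P' L hx)) :=
  PeriodicBox.isTiltedFrame hi'j' hP'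
    (nsmul_diff_mem_doublyTilted_right M P M' P' L hi'j' hi'i hi'j hj'i hj'j)
    (fun _ hx => dvd_diff_of_mem_doublyTilted_right M P M' P' L hx)

/-- **TWO DISJOINT PLANES COEXIST.** For four distinct axes `i, j, i', j'` (`d ≥ 4`) and
`P, P' ≥ 2` the doubly tilted box `ℤ^d / Γ₂` carries tilted diagonal frames in the plane `(i, j)`
(half period `P`) and in the plane `(i', j')` (half period `P'`) simultaneously — the disjointness
required by `TiltedFrameRigidity.lean` is the only obstruction to combining diagonal frames. -/
theorem isTiltedFrame_doublyTilted_both (hij : i ≠ j) (hi'j' : i' ≠ j') (hi'i : i' ≠ i)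
    (hi'j : i' ≠ j) (hj'i : j' ≠ i) (hj'j : j' ≠ j) (hP : 2 ≤ P) (hP' : 2 ≤ P') :
    (∃ (θ : _ →+ _) (v : _ →+ ZMod (2 * P)),
        IsTiltedFrame (PeriodicBox.unit (doublyTiltedLattice d i j i' j' M P M' P' L)) i j θ P v) ∧
      ∃ (θ' : _ →+ _) (v' : _ →+ ZMod (2 * P')),
        IsTiltedFrame (PeriodicBox.unit (doublyTiltedLattice d i j i' j' M P M' P' L)) i' j' θ' P' v' :=
  ⟨⟨_, _, isTiltedFrame_doublyTilted_left M P M' P' L hij hi'i hi'j hj'i hj'j hP⟩,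
    ⟨_, _, isTiltedFrame_doublyTilted_right M P M' P' L hi'j' hi'i hi'j hj'i hj'j hP'⟩⟩

/-! ## The remaining axes -/

/-- **No site frame along the four in-plane axes** (`TiltedFrameNoGo.lean` applied to the two
frames): on the doubly tilted box the Osterwalder–Seiler site/link mechanism is unavailable along
`i`, `j`, `i'`, `j'` — in `d = 4`, along every axis. -/
theorem not_isSiteFrame_doublyTilted_inPlane (hij : i ≠ j) (hi'j' : i' ≠ j') (hi'i : i' ≠ i)
    (hi'j : i' ≠ j) (hj'i : j' ≠ i) (hj'j : j' ≠ j) (hP : 2 ≤ P) (hP' : 2 ≤ P') {m : Fin d}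
    (hm : m = i ∨ m = j ∨ m = i' ∨ m = j') {σ : _ →+ _} {Q : ℕ} {h : _ →+ ZMod (2 * Q)} :
    ¬ IsSiteFrame (PeriodicBox.unit (doublyTiltedLattice d i j i' j' M P M' P' L)) m σ Q h := by
  rcases hm with hm | hm | hm | hm
  · exact (isTiltedFrame_doublyTilted_left M P M' P' L hij hi'i hi'j hj'i hj'j hP)
      |>.not_isSiteFrame_inPlane (Or.inl hm)
  · exact (isTiltedFrame_doublyTilted_left M P M' P' L hij hi'i hi'j hj'i hj'j hP)
      |>.not_isSiteFrame_inPlane (Or.inr hm)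
  · exact (isTiltedFrame_doublyTilted_right M P M' P' L hi'j' hi'i hi'j hj'i hj'j hP')
      |>.not_isSiteFrame_inPlane (Or.inl hm)
  · exact (isTiltedFrame_doublyTilted_right M P M' P' L hi'j' hi'i hi'j hj'i hj'j hP')
      |>.not_isSiteFrame_inPlane (Or.inr hm)

/-- **A site frame along every further axis of even period** (`k ∉ {i, j, i', j'}`, `L = 2Q`,
`Q ≥ 2`; `d ≥ 5`), by the classification `PeriodicBox.exists_isSiteFrame_iff`: `2Q e_k ∈ Γ₂` and
`Γ₂ ⊆ {2Q ∣ x_k}`. -/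
theorem isSiteFrame_doublyTilted_other {k : Fin d} (hki : k ≠ i) (hkj : k ≠ j) (hki' : k ≠ i')
    (hkj' : k ≠ j') {Q : ℕ} (hQ : 2 ≤ Q) :
    ∃ (σ : _ →+ _) (h : _ →+ ZMod (2 * Q)),
      IsSiteFrame (PeriodicBox.unit (doublyTiltedLattice d i j i' j' M P M' P' (2 * Q))) k σ Q h := by
  refine (PeriodicBox.exists_isSiteFrame_iff _ k Q).2 ⟨hQ, ?_, fun γ hγ => ?_⟩
  · rw [mem_doublyTiltedLattice_iff]
    simp only [Pi.smul_apply, Pi.single_eq_of_ne (Ne.symm hki), Pi.single_eq_of_ne (Ne.symm hkj),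
      Pi.single_eq_of_ne (Ne.symm hki'), Pi.single_eq_of_ne (Ne.symm hkj'), smul_zero, add_zero,
      sub_zero, dvd_zero, and_self, true_and]
    intro l _ _ _ _
    by_cases hl : l = k
    · subst hl
      rw [Pi.single_eq_same, nsmul_eq_mul, mul_one]
    · rw [Pi.single_eq_of_ne hl, smul_zero]
      exact dvd_zero _
  · exact ((mem_doublyTiltedLattice_iff d i j i' j' M P M' P' (2 * Q) γ).1 hγ).2.2 k hki hkj hki' hkj'

end TwoPlanes

end TiltedRP

end Summit.QuantumFields.GaugeBoot
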